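import Literature.NumberTheory.EllipticCurves.ZpExtensionEisensteinGradedInvariantsBoundProofs
import Mathlib.GroupTheory.Coset.Card
import HarnessLib

/-!
# The relaxed local condition «graded readout principal over `K_{∞,w}`» as a subgroup, and its index over the strict core
# (theorems only — no definition, no named fact, no instance, no `sorry`)

Topic `NumberTheory/EllipticCurves` (cell `pub/bsd-print-x9`, shared μ-crux stmt-BirchSwinnertonDyer-23428, clause (B5) letter
`Stmt.readoutLocalIndexP` «`∃ Fv : AddSubgroup …`»; ruling x10b-p2 LEAD g8 2026-08-28T22:46:37Z: `Fv := F′.comap (incLocIter j v e_w)` with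
`F′` = THIS condition at level `j + e_w`).  Sequel of `ZpExtensionEisensteinGradedInvariantsBoundProofs` (§5: the principal-on-`res⁻¹(ker κ)`
classes of `H¹(K_w, W_k / Fil_w W_k)` number `≤ p^{p^s}`).

* **`ZpExtension.OrdinaryFiltration.exists_addSubgroup_gradedPrincipal`** — there is a subgroup `F′ ≤ H¹(K_w, W_k)` with
  (i) `x ∈ F′ ↔` the image of `x` in `H¹(K_w, W_k / Fil_w W_k)` has a representative principal on `{σ | res σ ∈ ker κ}`;
  (ii) `ordinaryCore ≤ F′` (the core is the kernel of `H¹(K_w, W_k) → H¹(K_w, W_k / Fil_w W_k)`);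
  (iii) `Finite (↥F′ ⧸ core)` and `#(↥F′ ⧸ core) ≤ p^{p^s}` (the quotient embeds into the principal classes of §5), for every `k`, `m > p^s`,
  under the scalar hypotheses of §5 (`σ₀`, `n₀`, `Q₀`); and the `E[p^k]`-instance **`WeierstrassCurve.exists_addSubgroup_gradedPrincipal`**
  (`k ≥ 1`, good reduction with an ordinary point at `v ∋ p`).

References: [Howard2004HeegnerKolyvagin] B. Howard, Compositio Math. 140 (2004), Lemma 3.2.7 and proof of Thm. 2.2.10 (arXiv:1202.6340 p. 16–18);
[GreenbergLNM1716] §2–§3; [SerreGaloisCohomology1997] I §2.6(b).  BSD is not proved by any of this.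
-/

set_option autoImplicit false

noncomputable section

open Function NumberField IsDedekindDomain Field
open scoped NumberField TensorProduct ContRepresentation

namespace Literature.NumberTheory.EllipticCurves

open Literature.NumberTheory.GaloisRepresentations IwasawaAlgebra IwasawaAlgebra.EisensteinCoeff
open Literature.NumberTheory.GaloisRepresentations.DiscreteGaloisModule

namespace ZpExtension

variable {K : Type} [Field K] [NumberField K] {p : ℕ} [hp : Fact p.Prime] (κ : ZpExtension K p)
  {M : ℕ → Type} [∀ k, AddCommGroup (M k)] [∀ k, TopologicalSpace (M k)] [∀ k, DiscreteTopology (M k)]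
  {ρ : ∀ k, DiscreteGaloisModule K (M k)}
  {t : ∀ k, (ρ (k + 1)).toContRepresentation →ⁱL (ρ k).toContRepresentation} {m : ℕ} (hm : 1 ≤ m)
  {w : HeightOneSpectrum (𝓞 K)} (Φ : OrdinaryFiltration ρ t w)

namespace OrdinaryFiltration

set_option maxHeartbeats 400000 in
/-- **The relaxed condition `F′` at level `k`**: a subgroup of `H¹(K_w, W_k)` cut out by «the graded readout is principal on
`{σ | res σ ∈ ker κ}`», containing the strict ordinary core with index `≤ p^{p^s}` (uniformly in `k`, `m`).
[cite: Howard2004HeegnerKolyvagin, Lemma 3.2.7 and proof of Thm. 2.2.10 (arXiv:1202.6340 p. 16 L156–158, p. 17 L14–29)] [cite: GreenbergLNM1716, §2–§3] -/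
theorem exists_addSubgroup_gradedPrincipal (k : ℕ) [Finite (M k)]
    (σ₀ : absoluteGaloisGroup (w.adicCompletion K)) (n₀ : ℤ) (hn₀ : ¬ (p : ℤ) ∣ n₀)
    (hσ₀ : ∀ a : M k, GaloisRep.toLocal w (ρ k) σ₀ a - n₀ • a ∈ Φ.fil k)
    (Q₀ : M k) (hQ₀ : ∀ a : M k, ∃ n : ℤ, a - n • Q₀ ∈ Φ.fil k) {s : ℕ}
    (hσ : (κ (absGaloisRestrict K (w.adicCompletion K) σ₀)).toAdd = ((p ^ s : ℕ) : ℤ_[p])) (hms : p ^ s < m) :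
    ∃ F' : AddSubgroup (galoisCohomology ((κ.eisensteinTwist (ρ k) hm k).toLocal (Sum.inr w)) 1),
      (∀ x, x ∈ F' ↔ ∃ φ : contOneCocycles ((GaloisRep.toLocal w (κ.eisensteinTwist (ρ k) hm k)).quotient (Φ.twistedFil k)
            (Φ.twistedFil_le_comap hm k)).toTopRep,
          oneCocycleClass _ φ = DiscreteGaloisModule.quotientMap (GaloisRep.toLocal w (κ.eisensteinTwist (ρ k) hm k))
            (Φ.twistedFil k) (Φ.twistedFil_le_comap hm k) 1 x ∧
          ∃ v : EisensteinCoeff.Twisted p m k (M k) ⧸ Φ.twistedFil k,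
            ∀ σ : absoluteGaloisGroup (w.adicCompletion K), absGaloisRestrict K (w.adicCompletion K) σ ∈ κ.kerSubgroup →
              φ.1 σ = (GaloisRep.toLocal w (κ.eisensteinTwist (ρ k) hm k)).quotient (Φ.twistedFil k)
                (Φ.twistedFil_le_comap hm k) σ v - v) ∧
      Φ.ordinaryCore hm k ≤ F' ∧ Finite (↥F' ⧸ (Φ.ordinaryCore hm k).addSubgroupOf F') ∧
      Nat.card (↥F' ⧸ (Φ.ordinaryCore hm k).addSubgroupOf F') ≤ p ^ (p ^ s) := by
  classical
  -- the quotient representation as an object of `TopRep`, and the graded map `gr = H¹(W_k → W_k / Fil_w W_k)`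
  set X : TopRep ℤ (absoluteGaloisGroup (w.adicCompletion K)) :=
    ((GaloisRep.toLocal w (κ.eisensteinTwist (ρ k) hm k)).quotient (Φ.twistedFil k) (Φ.twistedFil_le_comap hm k)).toTopRep
    with hXdef
  let gr : galoisCohomology ((κ.eisensteinTwist (ρ k) hm k).toLocal (Sum.inr w)) 1 →+ continuousCohomology 1 X :=
    DiscreteGaloisModule.quotientMap (GaloisRep.toLocal w (κ.eisensteinTwist (ρ k) hm k)) (Φ.twistedFil k)
      (Φ.twistedFil_le_comap hm k) 1
  have hgr : ∀ x, gr x = DiscreteGaloisModule.quotientMap (GaloisRep.toLocal w (κ.eisensteinTwist (ρ k) hm k))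
      (Φ.twistedFil k) (Φ.twistedFil_le_comap hm k) 1 x := fun _ ↦ rfl
  -- the principal-on-`res⁻¹(ker κ)` classes form a subgroup `P` of `H¹(K_w, W_k / Fil_w W_k)`
  have hzero : ∃ φ : contOneCocycles X, oneCocycleClass X φ = 0 ∧ ∃ v : X, ∀ σ : absoluteGaloisGroup (w.adicCompletion K),
      absGaloisRestrict K (w.adicCompletion K) σ ∈ κ.kerSubgroup → φ.1 σ = X.ρ σ v - v :=
    ⟨0, oneCocycleClass_zero X, 0, fun σ _ ↦ by rw [map_zero, sub_zero]; rfl⟩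
  have hadd : ∀ y z : continuousCohomology 1 X,
      (∃ φ : contOneCocycles X, oneCocycleClass X φ = y ∧ ∃ v : X, ∀ σ : absoluteGaloisGroup (w.adicCompletion K),
        absGaloisRestrict K (w.adicCompletion K) σ ∈ κ.kerSubgroup → φ.1 σ = X.ρ σ v - v) →
      (∃ φ : contOneCocycles X, oneCocycleClass X φ = z ∧ ∃ v : X, ∀ σ : absoluteGaloisGroup (w.adicCompletion K),
        absGaloisRestrict K (w.adicCompletion K) σ ∈ κ.kerSubgroup → φ.1 σ = X.ρ σ v - v) →
      (∃ φ : contOneCocycles X, oneCocycleClass X φ = y + z ∧ ∃ v : X, ∀ σ : absoluteGaloisGroup (w.adicCompletion K),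
        absGaloisRestrict K (w.adicCompletion K) σ ∈ κ.kerSubgroup → φ.1 σ = X.ρ σ v - v) := by
    intro y z hy hz
    obtain ⟨φ, hφ, v, hv⟩ := hy
    obtain ⟨ψ, hψ, u, hu⟩ := hz
    refine ⟨φ + ψ, by rw [oneCocycleClass_add, hφ, hψ], v + u, fun σ hσ ↦ ?_⟩
    change φ.1 σ + ψ.1 σ = _
    rw [hv σ hσ, hu σ hσ, map_add]
    abel
  have hneg : ∀ y : continuousCohomology 1 X,
      (∃ φ : contOneCocycles X, oneCocycleClass X φ = y ∧ ∃ v : X, ∀ σ : absoluteGaloisGroup (w.adicCompletion K),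
        absGaloisRestrict K (w.adicCompletion K) σ ∈ κ.kerSubgroup → φ.1 σ = X.ρ σ v - v) →
      (∃ φ : contOneCocycles X, oneCocycleClass X φ = -y ∧ ∃ v : X, ∀ σ : absoluteGaloisGroup (w.adicCompletion K),
        absGaloisRestrict K (w.adicCompletion K) σ ∈ κ.kerSubgroup → φ.1 σ = X.ρ σ v - v) := by
    intro y hy
    obtain ⟨φ, hφ, v, hv⟩ := hy
    refine ⟨-φ, ?_, -v, fun σ hσ ↦ ?_⟩
    · rw [← zero_sub, oneCocycleClass_sub, oneCocycleClass_zero, hφ, zero_sub]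
    · change -(φ.1 σ) = _
      rw [hv σ hσ, map_neg]
      abel
  let P : AddSubgroup (continuousCohomology 1 X) :=
    { carrier := {y | ∃ φ : contOneCocycles X, oneCocycleClass X φ = y ∧ ∃ v : X,
        ∀ σ : absoluteGaloisGroup (w.adicCompletion K), absGaloisRestrict K (w.adicCompletion K) σ ∈ κ.kerSubgroup →
          φ.1 σ = X.ρ σ v - v}
      zero_mem' := hzero
      add_mem' := fun {a b} ha hb ↦ hadd a b ha hb
      neg_mem' := fun {a} ha ↦ hneg a ha }
  refine ⟨P.comap gr, fun x ↦ ?_, fun x hx ↦ ?_, ?_⟩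
  · rw [AddSubgroup.mem_comap]
    exact Iff.rfl
  · -- the core is the kernel of `gr`
    have h0 : gr x = 0 := (Φ.mem_ordinaryCore_iff hm k x).1 hx
    rw [AddSubgroup.mem_comap, h0]
    exact P.zero_mem
  · -- `F′ ⧸ core ↪ P`, and `#P ≤ p^{p^s}` (§5 of the graded-invariants file)
    have h5 := Φ.finite_and_natCard_setOf_oneCocycleClass_quotient_twistedFil_principal_le_pow κ hm k σ₀ n₀ hn₀
      hσ₀ Q₀ hQ₀ hσ hms
    obtain ⟨hfin, hle⟩ := h5
    haveI : Finite P := hfin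
    have hcardP : Nat.card P ≤ p ^ (p ^ s) := hle
    let θ : ↥(P.comap gr) →+ ↥P := (gr.comp (P.comap gr).subtype).codRestrict P fun x ↦ x.2
    have hθker : ∀ x : P.comap gr, (x : galoisCohomology ((κ.eisensteinTwist (ρ k) hm k).toLocal (Sum.inr w)) 1) ∈
        Φ.ordinaryCore hm k ↔ θ x = 0 := by
      intro x
      have e1 : θ x = 0 ↔ gr x = 0 :=
        ⟨fun h ↦ congrArg Subtype.val h, fun h ↦ Subtype.ext h⟩
      rw [e1]
      exact Φ.mem_ordinaryCore_iff hm k _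
    haveI : ((Φ.ordinaryCore hm k).addSubgroupOf (P.comap gr)).Normal := inferInstance
    let θbar : ↥(P.comap gr) ⧸ (Φ.ordinaryCore hm k).addSubgroupOf (P.comap gr) →+ ↥P :=
      QuotientAddGroup.lift _ θ (fun x hx ↦ (hθker x).1 hx)
    have hinj : Function.Injective θbar := by
      rw [injective_iff_map_eq_zero]
      intro q hq
      obtain ⟨x, rfl⟩ := QuotientAddGroup.mk_surjective q
      rw [QuotientAddGroup.eq_zero_iff]
      exact (hθker x).2 hq
    exact ⟨Finite.of_injective θbar hinj, (Nat.card_le_card_of_injective θbar hinj).trans hcardP⟩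

end OrdinaryFiltration

end ZpExtension

end Literature.NumberTheory.EllipticCurves
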